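import Summits.CriticalPhenomena.PercolationContinuityZ3.Theses.PercNonProliferation
import Summits.CriticalPhenomena.PercolationContinuityZ3.Theorems.NonProliferation.Negative.AboveSix
import Summits.CriticalPhenomena.PercolationContinuityZ3.Theorems.PercNonProliferationNonProliferationStubAnchor
import Literature.Probability.Percolation.KestenTheorem
import Literature.Probability.Percolation.RSW
import HarnessLib

/-!
# Crux `PercNonProliferation.NonProliferation` (stmt-CriticalPhenomena-4444), line `boundary-pinning` — stub `stub_innerCellCount`

Helper file for the lead's skeleton of line `boundary-pinning` (payload slug `Sketch`,
`Cruxes/NonProliferation/Lines/boundary_pinning.lean`, prover-line-stmt-CriticalPhenomena-4444-c1).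
Proves exactly the registered stub signature `stub_innerCellCount`; lands with
`--supports stmt-CriticalPhenomena-4444`.

This is the deterministic half of the unconditional support `PowerCap` of the line: the `k+1`
pairwise-unjoined representatives `x i ∈ B(n)` of `repEvent d k n` (each joined inside `B(2n)` to the
outer sphere `∂ⁱⁿB(2n)`) are charged to the cells `Q ∈ 𝒬` of a family covering the INNER sphere
`∂ⁱⁿB(n)`.

* First exit (`StubInnerCellCount.exists_exit`): for `n ≥ 1` the target `y i ∈ ∂ⁱⁿB(2n)` is not in
  `B(n)` (`StubAnchor.not_mem_innerBoundary_of_mem_box`), so the open path from `x i` leaves `B(n)`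
  through a point `w i ∈ ∂ⁱⁿB(n)` joined to `x i` inside `B(n) ⊆ B(2n)`
  (`exists_mem_innerBoundary_openConnIn`, `openConnIn_mono`, `box_mono`).
* Hence `w i` is joined inside `B(2n)` to `∂ⁱⁿB(2n)` (through `x i`), the `w i` are pairwise unjoined
  inside `B(2n)` (else `x i ↔ x j`), in particular `w` is injective (`openConnIn_refl`).
* Choose cells `c i ∈ 𝒬` containing `w i` (cover hypothesis) and count fibrewise
  (`Finset.card_eq_sum_card_fiberwise`): a fibre with two indices `i ≠ j` puts `ω` in the indicated
  two-crosser event of its cell `Q` and injects into `Q` via `w`, so it has `≤ |Q|` = indicator value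
  elements; any other fibre has `≤ 1` element. Summing over `Q ∈ 𝒬` gives
  `k + 1 ≤ |𝒬| + Σ_Q |Q|·1[event Q]`.
-/

noncomputable section

namespace Summit.CriticalPhenomena.PercolationContinuityZ3.Theorems.NonProliferation

open MeasureTheory Filter Topology
open Literature.Probability.LatticeModels Literature.Probability.Percolation
open Summit.CriticalPhenomena.PercolationContinuityZ3.Theorems.NonProliferation.Negative

namespace StubInnerCellCount

/-- `{x ↔ y in S}` implies `x ↔ y` in the whole open graph (map the induced walk along the
subgraph embedding). -/
theorem reachable_of_mem_openConnIn {V : Type*} {S : Set V} {x y : V} {ω : BondConfig V}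
    (h : ω ∈ openConnIn S x y) : (openGraph ω).Reachable x y := by
  obtain ⟨hx, hy, hr⟩ := h
  exact hr.map (SimpleGraph.Embedding.induce S).toHom

/-- `{x ↔ y in S}` is symmetric in `x`, `y` (membership form of `openConnIn_comm`). -/
theorem openConnIn_symm {V : Type*} {S : Set V} {x y : V} {ω : BondConfig V}
    (h : ω ∈ openConnIn S x y) : ω ∈ openConnIn S y x := by
  obtain ⟨hx, hy, hr⟩ := h
  exact ⟨hy, hx, hr.symm⟩

/-- **Inner exit point.** For `n ≥ 1` and a lattice configuration `ω`, a point `x ∈ B(n)` joined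
inside `B(2n)` to a point `y` of the outer sphere `∂ⁱⁿB(2n)` is joined inside `B(2n)` (indeed inside
`B(n)`) to a point `w` of the inner sphere `∂ⁱⁿB(n)`: `y ∉ B(n)`, so the open path leaves `B(n)`
(first-exit lemma `exists_mem_innerBoundary_openConnIn`). -/
theorem exists_exit {d n : ℕ} (hn : 1 ≤ n) {ω : BondConfig (Site d)}
    (hω : ω ⊆ (zdGraph d).edgeSet) {x y : Site d} (hx : x ∈ box d n)
    (hy : y ∈ innerBoundary (zdGraph d) (box d (2 * n)))
    (hxy : ω ∈ openConnIn (↑(box d (2 * n)) : Set (Site d)) x y) :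
    ∃ w ∈ innerBoundary (zdGraph d) (box d n),
      ω ∈ openConnIn (↑(box d (2 * n)) : Set (Site d)) x w := by
  have hyn : y ∉ box d n := fun h => StubAnchor.not_mem_innerBoundary_of_mem_box hn h hy
  obtain ⟨w, hw, hxw⟩ := exists_mem_innerBoundary_openConnIn hω (box d n) hx hyn
    (reachable_of_mem_openConnIn hxy)
  refine ⟨w, hw, openConnIn_mono ?_ x w hxw⟩
  exact Finset.coe_subset.2 (box_mono d (by omega))

end StubInnerCellCount

/-- **Stub `stub_innerCellCount`** of line `boundary-pinning` (crux stmt-CriticalPhenomena-4444):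
the deterministic count behind `PowerCap`. If a family of cells `𝒬` covers the inner sphere `∂ⁱⁿB(n)`
(`n ≥ 1`) and the lattice configuration `ω` has `k+1` representatives in `B(n)`, each joined inside
`B(2n)` to `∂ⁱⁿB(2n)` and pairwise unjoined inside `B(2n)` (`ω ∈ repEvent d k n`), then
`k + 1 ≤ |𝒬| + Σ_{Q ∈ 𝒬} |Q| · 1[two points of Q, each joined inside B(2n) to ∂ⁱⁿB(2n), unjoined](ω)`:
send each representative to an exit point of its crossing path on `∂ⁱⁿB(n)`; these are pairwise
unjoined, hence distinct; a cell receiving two of them carries the indicated event and receives at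
most `|Q|` of them, any other cell receives at most one. -/
theorem stub_innerCellCount :
    ∀ (d n k : ℕ) (𝒬 : Finset (Finset (Site d))) (ω : BondConfig (Site d)), 1 ≤ n → ω ⊆ (zdGraph d).edgeSet → (∀ y ∈ innerBoundary (zdGraph d) (box d n), ∃ Q ∈ 𝒬, y ∈ Q) → ω ∈ repEvent d k n → (k + 1 : ℝ) ≤ 𝒬.card + ∑ Q ∈ 𝒬, Set.indicator {ω' : BondConfig (Site d) | ∃ u ∈ Q, ∃ v ∈ Q, (∃ a ∈ innerBoundary (zdGraph d) (box d (2 * n)), ω' ∈ openConnIn (↑(box d (2 * n)) : Set (Site d)) u a) ∧ (∃ b ∈ innerBoundary (zdGraph d) (box d (2 * n)), ω' ∈ openConnIn (↑(box d (2 * n)) : Set (Site d)) v b) ∧ ω' ∉ openConnIn (↑(box d (2 * n)) : Set (Site d)) u v} (fun _ => (Q.card : ℝ)) ω := by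
  classical
  intro d n k 𝒬 ω hn hω hcover hrep
  obtain ⟨x, hx, hconn, hdisj⟩ := hrep
  -- exit points `w i ∈ ∂ⁱⁿB(n)` joined to `x i` inside `B(2n)`
  have hexit : ∀ i, ∃ w ∈ innerBoundary (zdGraph d) (box d n),
      ω ∈ openConnIn (↑(box d (2 * n)) : Set (Site d)) (x i) w := fun i => by
    obtain ⟨y, hy, hxy⟩ := hconn i
    exact StubInnerCellCount.exists_exit hn hω (hx i) hy hxy
  choose w hw hxw using hexit
  -- (A) each `w i` is joined inside `B(2n)` to the outer sphere
  have hA : ∀ i, ∃ a ∈ innerBoundary (zdGraph d) (box d (2 * n)),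
      ω ∈ openConnIn (↑(box d (2 * n)) : Set (Site d)) (w i) a := fun i => by
    obtain ⟨y, hy, hxy⟩ := hconn i
    exact ⟨y, hy, PlanarDuality.openConnIn_trans (StubInnerCellCount.openConnIn_symm (hxw i)) hxy⟩
  -- (B) the `w i` are pairwise unjoined inside `B(2n)`
  have hB : ∀ i j, i ≠ j → ω ∉ openConnIn (↑(box d (2 * n)) : Set (Site d)) (w i) (w j) :=
    fun i j hij hwij => hdisj i j hij
      (PlanarDuality.openConnIn_trans (PlanarDuality.openConnIn_trans (hxw i) hwij)
        (StubInnerCellCount.openConnIn_symm (hxw j)))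
  -- (C) hence `w` is injective
  have hC : Function.Injective w := fun i j hij => by
    by_contra hne
    refine hB i j hne ?_
    rw [hij]
    obtain ⟨-, hwj, -⟩ := hxw j
    exact openConnIn_refl hwj
  -- cells `c i ∈ 𝒬` containing `w i`
  have hcell : ∀ i, ∃ Q ∈ 𝒬, w i ∈ Q := fun i => hcover (w i) (hw i)
  choose c hc hwc using hcell
  -- fibrewise count
  have hfib : (Finset.univ : Finset (Fin (k + 1))).card =
      ∑ Q ∈ 𝒬, (Finset.univ.filter fun i => c i = Q).card :=
    Finset.card_eq_sum_card_fiberwise fun i _ => hc i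
  have hk : (k + 1 : ℝ) = ∑ Q ∈ 𝒬, ((Finset.univ.filter fun i => c i = Q).card : ℝ) := by
    have h := congrArg (Nat.cast (R := ℝ)) hfib
    rw [Finset.card_univ, Fintype.card_fin] at h
    push_cast at h
    exact h
  have h1 : (𝒬.card : ℝ) = ∑ Q ∈ 𝒬, (1 : ℝ) := by simp
  rw [hk, h1, ← Finset.sum_add_distrib]
  refine Finset.sum_le_sum fun Q hQ => ?_
  by_cases h2 : (Finset.univ.filter fun i => c i = Q).card ≤ 1
  · calc ((Finset.univ.filter fun i => c i = Q).card : ℝ) ≤ 1 := by exact_mod_cast h2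
      _ ≤ 1 + _ := le_add_of_nonneg_right (Set.indicator_nonneg (fun _ _ => Nat.cast_nonneg _) _)
  · push Not at h2
    obtain ⟨i, hi, j, hj, hij⟩ := Finset.one_lt_card.1 h2
    simp only [Finset.mem_filter, Finset.mem_univ, true_and] at hi hj
    rw [Set.indicator_of_mem]
    · have hle : (Finset.univ.filter fun i => c i = Q).card ≤ Q.card := by
        refine Finset.card_le_card_of_injOn w (fun i' hi' => ?_) hC.injOn
        have hi'' : c i' = Q := by simpa using hi'
        exact hi'' ▸ hwc i'
      calc ((Finset.univ.filter fun i => c i = Q).card : ℝ) ≤ Q.card := by exact_mod_cast hle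
        _ ≤ 1 + (Q.card : ℝ) := le_add_of_nonneg_left zero_le_one
    · exact ⟨w i, hi ▸ hwc i, w j, hj ▸ hwc j, hA i, hA j, hB i j hij⟩

end Summit.CriticalPhenomena.PercolationContinuityZ3.Theorems.NonProliferation

end
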